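import Summits.BirchSwinnertonDyer.Rank1Residual.X11b.Three.GoodReductionSubgroupNonsplitOdd
import Mathlib.RingTheory.Valuation.Discrete.IsDiscreteValuationRing
import Mathlib.Data.Int.WithZero
import HarnessLib

/-!
# X11b at `p = 3` (team N8/O2), JET3-KUMMER (α): the rank-one valuation of the layer is
# INTRINSIC — `w`, `hw`, `hφw` removed from the S15 interface (part 11)

HONEST FRAMING (cell `b2b-bsdres`, run/shared/lean/b2b/bsd-rank1-residual/, verbatim in every
file): the goal of the cell is to DELETE the COMBINATION-SHAPED residual classes of the
Birch–Swinnerton-Dyer formula for ALL analytic-rank `≤ 1` elliptic curves over `ℚ` — "full BSD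
formula for every rank `≤ 1` curve in class `C`" assembled STRICTLY from published theorems — so
that the rank-`≤ 1` remainder becomes exactly the CONSTRUCTION-SHAPED classes, which are TYPED
(missing-input `Prop`s), NOT attempted. This is not "finishing BSD". Team N8/O2 = `x11b3`, seat
`b2b-bsdres-x11b3-p4`, LEAD DEAL #7 R7-7 (p4 = S15 (i) + owner of record of the S15 interface),
part 11. THEOREMS ONLY: no definition, no named fact, no `sorry`; nothing is booked; `JET@p|N`
NOT discharged.

## What

Parts 6, 8 and 10 (`GoodReductionSubgroupFormalInputs`, `…FormalH1`, `…NonsplitOdd`) state the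
formal-group half of (α) with three binders that no other S15 hand (p3 (ii), p8 (iii)(a), p1 (iv))
uses: a rank-one valuation `w : Valuation L ℝ≥0`, `hw : w.Integers R`, and the isometry
`hφw : ∀ x, w (φ x) = w x` of the Frobenius generator. For an abstract discrete valuation ring
`R` with `Frac R = L` all three are THEOREMS, so this file removes them:

* §1 **`exists_integers_and_map_eq`**: there is a valuation `w : Valuation L ℝ≥0` with
  `w.Integers R` which is moreover invariant under every ring automorphism `σ` of `L` with
  `σ(R) ⊆ R` and `σ⁻¹(R) ⊆ R`. Construction: Mathlib's adic valuation of the height-one prime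
  `IsDiscreteValuationRing.maximalIdeal R` on `L`, pushed to `ℝ≥0` along
  `WithZeroMulInt.toNNReal` (base `2`; any base `> 1` gives an equivalent valuation); integers by
  `IsDiscreteValuationRing.exists_lift_of_le_one`; invariance because `σ|_R` is a ring automorphism
  of the local ring `R`, hence preserves `𝔪` and every `𝔪ⁿ`, hence `intValuation` (the pattern of
  `Literature…X1ElevenDescentValuation.adicValNNReal_smul_eq`), and `x = a / b`.
  `exists_integers` is the bare existence.
* §2 the **`w`-free exports** (same statements as parts 8 / 10 with `w`, `hw`, `hφw` GONE; the
  isometry is derived from the standing hypothesis `hR : ∀ τ ∈ Aut(L/F), τ(R) ⊆ R`):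
  **`h1ker_of_adicComplete`** (the formal-group half `H¹(⟨φ⟩, E₁(L)) = 0` in cyclic form — the
  input of p3's `hα_of_h1ker_of_nonsplit_node` and p8's
  `hα_of_h1ker_of_hasSplitMultiplicativeReduction`), `cyclicH1_of_node_of_adicComplete`,
  **`hα_of_node_of_adicComplete`** (p1's hypothesis (α) of `JetchevKummerAtP` at a presented node),
  `exists_baseChange_eq_add_pow_smul_of_node_of_adicComplete` (Jetchev Prop. 4.1 at `v` modulo
  (a), (b), cocycle), and the option-(B) form `hα_of_nonsplit_odd_of_adicComplete`.

RESIDUAL BINDERS of the formal-group half after this file (all standard for the unramified layer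
`L_w / ℚ₃`, none constructible from Mathlib today — S15 (iii)(b/c) of R7-7): `hR`,
`[IsAdicComplete 𝔪 R]`, `[Finite k]`, `hcard : Nat.card k = qⁿ`, `hfrob`, `hn : φⁿ = 1` (and `hφ`
for (α)), a uniformiser of `R` coming from `F`, `X ⊗ L` elliptic.

References (locators only; no new fact): [cite: MilneADT2006, Ch. I Prop. 3.8]
[cite: SerreLocalFields1979, II §2–§3 (discrete valuations and their automorphisms)]
[cite: NeukirchANT1999, Ch. II §3].

## Design

No definitions (the valuation is produced inside an `∃`); `noncomputable section`;
`open scoped Classical NNReal`. Axioms: `propext`, `Classical.choice`, `Quot.sound`.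
-/

noncomputable section

open scoped Classical NNReal

namespace Summit.BirchSwinnertonDyer.Rank1Residual.X11b.Three.JetchevKummer

open WeierstrassCurve Literature.NumberTheory.EllipticCurves IsDedekindDomain WithZeroMulInt

universe u

/-! ### §1 The intrinsic rank-one valuation of a discrete valuation ring -/

section Valuation

variable (L : Type u) [Field L] (R : Type*) [CommRing R] [IsDomain R] [IsDiscreteValuationRing R]
  [Algebra R L] [IsFractionRing R L]

/-- A ring automorphism `e` of the local ring `R` preserves every power of the maximal ideal:
`e r ∈ 𝔪ⁿ ↔ r ∈ 𝔪ⁿ`. [folklore] -/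
theorem ringEquiv_mem_maximalIdeal_pow_iff (e : R ≃+* R) (n : ℕ) (r : R) :
    e r ∈ IsLocalRing.maximalIdeal R ^ n ↔ r ∈ IsLocalRing.maximalIdeal R ^ n := by
  -- any automorphism maps `𝔪` onto `𝔪`
  have hmap : ∀ g : R ≃+* R,
      Ideal.map (g : R →+* R) (IsLocalRing.maximalIdeal R) = IsLocalRing.maximalIdeal R := by
    intro g
    apply le_antisymm
    · rw [Ideal.map_le_iff_le_comap]
      intro r hr
      rw [Ideal.mem_comap, IsLocalRing.mem_maximalIdeal, mem_nonunits_iff]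
      rw [IsLocalRing.mem_maximalIdeal, mem_nonunits_iff] at hr
      intro hu
      apply hr
      have := hu.map (g.symm : R →+* R)
      simpa using this
    · intro r hr
      have hr' : g.symm r ∈ IsLocalRing.maximalIdeal R := by
        rw [IsLocalRing.mem_maximalIdeal, mem_nonunits_iff] at hr ⊢
        intro hu
        apply hr
        have := hu.map (g : R →+* R)
        simpa using this
      have := Ideal.mem_map_of_mem (g : R →+* R) hr'
      simpa using this
  have hpow : ∀ g : R ≃+* R,
      Ideal.map (g : R →+* R) (IsLocalRing.maximalIdeal R ^ n) = IsLocalRing.maximalIdeal R ^ n :=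
    fun g ↦ by rw [Ideal.map_pow, hmap g]
  constructor
  · intro h
    have := Ideal.mem_map_of_mem (e.symm : R →+* R) h
    rw [hpow e.symm] at this
    simpa using this
  · intro h
    have := Ideal.mem_map_of_mem (e : R →+* R) h
    rwa [hpow e] at this

/-- A ring automorphism of `R` preserves the `𝔪`-adic valuation on `R`. [folklore] -/
theorem intValuation_ringEquiv_eq (e : R ≃+* R) (r : R) :
    (IsDiscreteValuationRing.maximalIdeal R).intValuation (e r) =
      (IsDiscreteValuationRing.maximalIdeal R).intValuation r := by
  set v := IsDiscreteValuationRing.maximalIdeal R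
  by_cases hr : r = 0
  · subst hr; simp
  have her : e r ≠ 0 := (map_ne_zero_iff e e.injective).mpr hr
  have key : ∀ n : ℕ, v.intValuation (e r) ≤ WithZero.exp (-(n : ℤ)) ↔
      v.intValuation r ≤ WithZero.exp (-(n : ℤ)) := fun n ↦ by
    rw [v.intValuation_le_pow_iff_mem, v.intValuation_le_pow_iff_mem]
    exact ringEquiv_mem_maximalIdeal_pow_iff R e n r
  obtain ⟨a, ha⟩ : ∃ a : ℕ, v.intValuation (e r) = WithZero.exp (-(a : ℤ)) := by
    rw [v.intValuation_if_neg her]; exact ⟨_, rfl⟩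
  obtain ⟨b, hb⟩ : ∃ b : ℕ, v.intValuation r = WithZero.exp (-(b : ℤ)) := by
    rw [v.intValuation_if_neg hr]; exact ⟨_, rfl⟩
  rw [ha, hb] at key ⊢
  exact le_antisymm ((key b).mpr le_rfl) ((key a).mp le_rfl)

/-- **The rank-one valuation of `L = Frac R` with valuation ring `R`, invariant under the
automorphisms of `L` preserving `R`.** There is `w : Valuation L ℝ≥0` with `w.Integers R` such
that `w (σ x) = w x` for every ring automorphism `σ` of `L` with `σ(R) ⊆ R` and `σ⁻¹(R) ⊆ R`.
(`w = 2^{-ord_𝔪}`; `σ` restricts to a ring automorphism of `R`, which preserves `𝔪ⁿ` for all `n`.)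
[cite: SerreLocalFields1979, II §2–§3] -/
theorem exists_integers_and_map_eq :
    ∃ w : Valuation L ℝ≥0, w.Integers R ∧ ∀ σ : L ≃+* L,
      (∀ x : L, x ∈ Set.range (algebraMap R L) → σ x ∈ Set.range (algebraMap R L)) →
      (∀ x : L, x ∈ Set.range (algebraMap R L) → σ.symm x ∈ Set.range (algebraMap R L)) →
        ∀ x : L, w (σ x) = w x := by
  set v := IsDiscreteValuationRing.maximalIdeal R with hv
  have hinj : Function.Injective (algebraMap R L) := IsFractionRing.injective R L
  refine ⟨(v.valuation L).map (toNNReal two_ne_zero) (toNNReal_strictMono one_lt_two).monotone,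
    ⟨hinj, fun x ↦ ?_, fun x hx ↦ ?_⟩, fun σ hσ hσ' x ↦ ?_⟩
  · rw [Valuation.map_apply, toNNReal_le_one_iff one_lt_two]
    exact v.valuation_le_one x
  · rw [Valuation.map_apply, toNNReal_le_one_iff one_lt_two] at hx
    exact IsDiscreteValuationRing.exists_lift_of_le_one hx
  · -- `σ` restricted to `R`, as a ring automorphism `e`
    have hex : ∀ a : R, ∃ a' : R, algebraMap R L a' = σ (algebraMap R L a) := fun a ↦ by
      obtain ⟨a', ha'⟩ := hσ (algebraMap R L a) ⟨a, rfl⟩; exact ⟨a', ha'⟩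
    have hex' : ∀ a : R, ∃ a' : R, algebraMap R L a' = σ.symm (algebraMap R L a) := fun a ↦ by
      obtain ⟨a', ha'⟩ := hσ' (algebraMap R L a) ⟨a, rfl⟩; exact ⟨a', ha'⟩
    choose f hf using hex
    choose g hg using hex'
    let e : R ≃+* R :=
      { toFun := f
        invFun := g
        left_inv := fun a ↦ hinj (by rw [hg, hf, RingEquiv.symm_apply_apply])
        right_inv := fun a ↦ hinj (by rw [hf, hg, RingEquiv.apply_symm_apply])
        map_mul' := fun a b ↦ hinj (by simp only [hf, map_mul])
        map_add' := fun a b ↦ hinj (by simp only [hf, map_add]) }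
    have he : ∀ a : R, algebraMap R L (e a) = σ (algebraMap R L a) := hf
    -- on `R`
    have hR : ∀ a : R, v.valuation L (σ (algebraMap R L a)) = v.valuation L (algebraMap R L a) :=
      fun a ↦ by
      rw [← he, HeightOneSpectrum.valuation_of_algebraMap, HeightOneSpectrum.valuation_of_algebraMap,
        intValuation_ringEquiv_eq R e a]
    -- on `L = Frac R`
    obtain ⟨a, b, -, rfl⟩ := IsFractionRing.div_surjective (A := R) x
    simp only [Valuation.map_apply]
    congr 1
    rw [map_div₀ σ, map_div₀, map_div₀, hR a, hR b]

/-- There is a rank-one valuation of `L = Frac R` with valuation ring `R`. [folklore] -/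
theorem exists_integers : ∃ w : Valuation L ℝ≥0, w.Integers R :=
  (exists_integers_and_map_eq L R).imp fun _ h ↦ h.1

/-- For the valuation of `exists_integers_and_map_eq`: every `F`-automorphism of `L` is an
isometry as soon as all of `Aut(L/F)` preserves `R` (the standing hypothesis `hR` of the S15
files). [folklore] -/
theorem exists_integers_and_algEquiv_eq {F : Type u} [Field F] [Algebra F L]
    (hR : ∀ (τ : L ≃ₐ[F] L) (x : L), x ∈ Set.range (algebraMap R L) →
      τ x ∈ Set.range (algebraMap R L)) :
    ∃ w : Valuation L ℝ≥0, w.Integers R ∧ ∀ (σ : L ≃ₐ[F] L) (x : L), w (σ x) = w x := by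
  obtain ⟨w, hw, hiso⟩ := exists_integers_and_map_eq L R
  refine ⟨w, hw, fun σ x ↦ ?_⟩
  have h := hiso (σ : L ≃+* L) (fun y hy ↦ hR σ y hy) (fun y hy ↦ ?_) x
  · simpa using h
  · have := hR σ.symm y hy
    simpa using this

end Valuation

/-! ### §2 The `w`-free exports of the formal-group half and of (α) -/

section Exports

variable {F : Type u} [Field F] (X : WeierstrassCurve F) (L : Type u) [Field L] [Algebra F L]
  (R : Type*) [CommRing R] [IsDomain R] [IsDiscreteValuationRing R] [Algebra R L]
  [IsFractionRing R L]

/-- **The formal-group half `H¹(⟨φ⟩, E₁(L)) = 0` in cyclic form, intrinsic statement** (part 8's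
`h1ker_of_complete` with the valuation binders `w`, `hw`, `hφw` discharged by §1): for `R` a
complete discrete valuation ring with `Frac R = L` and finite residue field of order `qⁿ`, all of
`Aut(L/F)` preserving `R`, `φ` with `φⁿ = 1` inducing `x ↦ x^q` on `k`, a uniformiser of `R` from
`F`, and `X ⊗ L` elliptic with `R`-model `W₀`: every `m ∈ E₁(L)` with `Σ_{j<n} φʲ m = O` is
`φ P − P` with `P ∈ E₁(L)`. Milne, *ADT* I Prop. 3.8 (proof, identity component); Serre, *Local
Fields* V §2, XIII §1. [cite: MilneADT2006, Ch. I Prop. 3.8] -/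
theorem h1ker_of_adicComplete [IsAdicComplete (IsLocalRing.maximalIdeal R) R]
    [Finite (IsLocalRing.ResidueField R)] [(X.baseChange L).IsElliptic]
    (W₀ : WeierstrassCurve R) (hX : X.baseChange L = W₀.baseChange L)
    (hR : ∀ (τ : L ≃ₐ[F] L) (x : L), x ∈ Set.range (algebraMap R L) →
      τ x ∈ Set.range (algebraMap R L))
    (φ : L ≃ₐ[F] L) {q n : ℕ} (hn : φ ^ n = 1)
    (hcard : Nat.card (IsLocalRing.ResidueField R) = q ^ n)
    (hfrob : ∀ a : R, ∃ a' : R, algebraMap R L a' = φ (algebraMap R L a) ∧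
      IsLocalRing.residue R a' = IsLocalRing.residue R a ^ q)
    {ϖ : R} (hϖ : Irreducible ϖ) {π : F} (hπ : algebraMap F L π = algebraMap R L ϖ) :
    ∀ m ∈ {Q : (X.baseChange L).toAffine.Point | ∀ (x y : L)
        (h : (X.baseChange L).toAffine.Nonsingular x y), Q = .some x y h →
          x ∉ Set.range (algebraMap R L)},
      ∑ j ∈ Finset.range n, (φ ^ j) • m = 0 →
        ∃ P ∈ {Q : (X.baseChange L).toAffine.Point | ∀ (x y : L)
          (h : (X.baseChange L).toAffine.Nonsingular x y), Q = .some x y h →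
            x ∉ Set.range (algebraMap R L)}, φ • P - P = m := by
  obtain ⟨w, hw, hiso⟩ := exists_integers_and_algEquiv_eq L R hR
  exact h1ker_of_complete X L R w hw W₀ hX hR φ (hiso φ) hn hcard hfrob hϖ hπ

/-- **`H¹(⟨φ⟩, E₀(L)) = 0` in cyclic form at a presented node over a complete unramified layer,
intrinsic statement** (part 10's `cyclicH1_of_node_of_complete` without `w`, `hw`, `hφw`).
[cite: MilneADT2006, Ch. I Prop. 3.8] -/
theorem cyclicH1_of_node_of_adicComplete [IsAdicComplete (IsLocalRing.maximalIdeal R) R]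
    [Finite (IsLocalRing.ResidueField R)] [(X.baseChange L).IsElliptic] [(X.baseChange L).IsMinimal R]
    (W₀ : WeierstrassCurve R) (hX : X.baseChange L = W₀.baseChange L)
    (hR : ∀ (τ : L ≃ₐ[F] L) (x : L), x ∈ Set.range (algebraMap R L) →
      τ x ∈ Set.range (algebraMap R L))
    {x₀ y₀ α₁ α₂ : IsLocalRing.ResidueField R}
    (hW : W₀.map (IsLocalRing.residue R) = singularModel x₀ y₀ α₁ α₂) (hα : α₁ ≠ α₂)
    (φ : L ≃ₐ[F] L) {q n : ℕ} (hn : φ ^ n = 1)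
    (hcard : Nat.card (IsLocalRing.ResidueField R) = q ^ n)
    (hfrob : ∀ a : R, ∃ a' : R, algebraMap R L a' = φ (algebraMap R L a) ∧
      IsLocalRing.residue R a' = IsLocalRing.residue R a ^ q)
    {ϖ : R} (hϖ : Irreducible ϖ) {π : F} (hπ : algebraMap F L π = algebraMap R L ϖ) :
    ∀ m ∈ (X.baseChange L).goodReductionSubgroup R, ∑ j ∈ Finset.range n, (φ ^ j) • m = 0 →
      ∃ P ∈ (X.baseChange L).goodReductionSubgroup R, φ • P - P = m := by
  obtain ⟨w, hw, hiso⟩ := exists_integers_and_algEquiv_eq L R hR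
  exact cyclicH1_of_node_of_complete X L R w hw W₀ hX hR hW hα φ (hiso φ) hn hcard hfrob hϖ hπ

/-- **(α) at a presented node over a complete unramified layer, intrinsic statement** — p1's
hypothesis `hα` of `JetchevKummerAtP` (part 8's `hα_of_node_of_complete` without `w`, `hw`,
`hφw`). Hypotheses left: `R` complete DVR of `L` with finite residue field `k`, `#k = qⁿ`, all of
`Gal = Aut(L/F)` preserving `R`, `Gal = ⟨φ⟩` with `φⁿ = 1` and `φ ≡ (x ↦ x^q)` on `k`, a
uniformiser of `R` from `F`, `X ⊗ L` elliptic with minimal `R`-model `W₀` reducing to the node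
`singularModel x₀ y₀ α₁ α₂`, `α₁ ≠ α₂`. [cite: MilneADT2006, Ch. I Prop. 3.8]
[cite: SilvermanAEC2009, VII.2 Prop. 2.1, Exercise 3.5(a)] -/
theorem hα_of_node_of_adicComplete [IsAdicComplete (IsLocalRing.maximalIdeal R) R]
    [Finite (IsLocalRing.ResidueField R)] [(X.baseChange L).IsElliptic] [(X.baseChange L).IsMinimal R]
    (W₀ : WeierstrassCurve R) (hX : X.baseChange L = W₀.baseChange L)
    (hR : ∀ (τ : L ≃ₐ[F] L) (x : L), x ∈ Set.range (algebraMap R L) →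
      τ x ∈ Set.range (algebraMap R L))
    {x₀ y₀ α₁ α₂ : IsLocalRing.ResidueField R}
    (hW : W₀.map (IsLocalRing.residue R) = singularModel x₀ y₀ α₁ α₂) (hα : α₁ ≠ α₂)
    (φ : L ≃ₐ[F] L) (hφ : ∀ σ : L ≃ₐ[F] L, σ ∈ Subgroup.zpowers φ)
    {q n : ℕ} (hn : φ ^ n = 1) (hcard : Nat.card (IsLocalRing.ResidueField R) = q ^ n)
    (hfrob : ∀ a : R, ∃ a' : R, algebraMap R L a' = φ (algebraMap R L a) ∧
      IsLocalRing.residue R a' = IsLocalRing.residue R a ^ q)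
    {ϖ : R} (hϖ : Irreducible ϖ) {π : F} (hπ : algebraMap F L π = algebraMap R L ϖ) :
    ∀ Q : (X.baseChange L).toAffine.Point,
      (∀ σ : L ≃ₐ[F] L, σ • Q - Q ∈ (X.baseChange L).goodReductionSubgroup R) →
        ∃ Q' : (X.baseChange L).toAffine.Point, (∀ σ : L ≃ₐ[F] L, σ • Q' = Q') ∧
          Q - Q' ∈ (X.baseChange L).goodReductionSubgroup R := by
  obtain ⟨w, hw, hiso⟩ := exists_integers_and_algEquiv_eq L R hR
  exact hα_of_node_of_complete X L R w hw W₀ hX hR hW hα φ hφ (hiso φ) hn hcard hfrob hϖ hπ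

/-- **Jetchev's Prop. 4.1 at a bad place `v` with a presented node, modulo p1's inputs (a), (b)
and the cocycle ONLY, intrinsic statement** (part 8's
`exists_baseChange_eq_add_pow_smul_of_node_of_complete` without `w`, `hw`, `hφw`):
`T = ι(t₀ + p^m t₁)` with `t₀ ∈ E₀(K_v)`. The flag `JET@p|N` is NOT discharged.
[cite: Jetchev2008, Prop. 4.1 (p. 819)] [cite: GrossLMS1991, Prop. 6.2 (1), pp. 244–245]
[cite: MilneADT2006, Ch. I Prop. 3.8] -/
theorem exists_baseChange_eq_add_pow_smul_of_node_of_adicComplete [IsGalois F L]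
    [IsAdicComplete (IsLocalRing.maximalIdeal R) R] [Finite (IsLocalRing.ResidueField R)]
    [(X.baseChange L).IsElliptic] [(X.baseChange L).IsMinimal R]
    (R₀ : Type*) [CommRing R₀] [IsDomain R₀] [IsDiscreteValuationRing R₀] [Algebra R₀ F]
    [IsFractionRing R₀ F] [Algebra R₀ R] [Algebra R₀ L] [IsScalarTower R₀ R L]
    [IsScalarTower R₀ F L] [IsLocalHom (algebraMap R₀ R)] [(X.baseChange F).IsMinimal R₀]
    (W₀ : WeierstrassCurve R) (hX : X.baseChange L = W₀.baseChange L)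
    (hR : ∀ (τ : L ≃ₐ[F] L) (x : L), x ∈ Set.range (algebraMap R L) →
      τ x ∈ Set.range (algebraMap R L))
    {x₀ y₀ α₁ α₂ : IsLocalRing.ResidueField R}
    (hW : W₀.map (IsLocalRing.residue R) = singularModel x₀ y₀ α₁ α₂) (hα : α₁ ≠ α₂)
    (φ : L ≃ₐ[F] L) (hφ : ∀ σ : L ≃ₐ[F] L, σ ∈ Subgroup.zpowers φ)
    {q n : ℕ} (hn : φ ^ n = 1) (hcard : Nat.card (IsLocalRing.ResidueField R) = q ^ n)
    (hfrob : ∀ a : R, ∃ a' : R, algebraMap R L a' = φ (algebraMap R L a) ∧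
      IsLocalRing.residue R a' = IsLocalRing.residue R a ^ q)
    {ϖ : R} (hϖ : Irreducible ϖ) {π : F} (hπ : algebraMap F L π = algebraMap R L ϖ)
    {p m n' : ℕ} (hcop : Nat.Coprime n' (p ^ m)) {U P T : (X.baseChange L).toAffine.Point}
    {Rσ : (L ≃ₐ[F] L) → (X.baseChange L).toAffine.Point}
    (hT : ∀ σ : L ≃ₐ[F] L, σ • T = T)
    (hP : (n' : ℤ) • P ∈ (X.baseChange L).goodReductionSubgroup R)
    (hRσ : ∀ σ : L ≃ₐ[F] L, (n' : ℤ) • Rσ σ ∈ (X.baseChange L).goodReductionSubgroup R)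
    (hU : ∀ σ : L ≃ₐ[F] L, σ • U - U = Rσ σ) (hpU : ((p ^ m : ℕ) : ℤ) • U = P - T) :
    ∃ t₀ t₁ : (X.baseChange F).toAffine.Point,
      t₀ ∈ (X.baseChange F).goodReductionSubgroup R₀ ∧
      T = Affine.Point.baseChange (W' := X.toAffine) F L (t₀ + ((p ^ m : ℕ) : ℤ) • t₁) := by
  obtain ⟨w, hw, hiso⟩ := exists_integers_and_algEquiv_eq L R hR
  exact exists_baseChange_eq_add_pow_smul_of_node_of_complete X L R w hw R₀ W₀ hX hR hW hα φ hφ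
    (hiso φ) hn hcard hfrob hϖ hπ hcop hT hP hRσ hU hpU

variable (L' : Type u) [Field L'] [Algebra F L'] [Algebra L L'] [IsScalarTower F L L']
  (R' : Type*) [CommRing R'] [IsDomain R'] [IsDiscreteValuationRing R'] [Algebra R' L']
  [IsFractionRing R' L'] [Algebra R R'] [Algebra R L'] [IsScalarTower R R' L'] [IsScalarTower R L L']

/-- **(α) at a non-split node with `[k : k_v]` odd by inflation (option (B)), intrinsic
statement** (part 10's `hα_of_nonsplit_odd` without `w'`, `hw'`, `hφ'w`).
[cite: MilneADT2006, Ch. I Prop. 3.8] [cite: SerreLocalFields1979, VII §6] -/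
theorem hα_of_nonsplit_odd_of_adicComplete [IsLocalHom (algebraMap R R')]
    [(X.baseChange L).IsMinimal R] [(X.baseChange L').IsMinimal R']
    [IsAdicComplete (IsLocalRing.maximalIdeal R') R'] [Finite (IsLocalRing.ResidueField R')]
    [(X.baseChange L').IsElliptic]
    (W₀' : WeierstrassCurve R') (hX' : X.baseChange L' = W₀'.baseChange L')
    (hR' : ∀ (τ : L' ≃ₐ[F] L') (x : L'), x ∈ Set.range (algebraMap R' L') →
      τ x ∈ Set.range (algebraMap R' L'))
    {x₀ y₀ α₁ α₂ : IsLocalRing.ResidueField R'}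
    (hW' : W₀'.map (IsLocalRing.residue R') = singularModel x₀ y₀ α₁ α₂) (hα : α₁ ≠ α₂)
    (φ : L ≃ₐ[F] L) (hφ : ∀ σ : L ≃ₐ[F] L, σ ∈ Subgroup.zpowers φ) {n : ℕ} (hn : φ ^ n = 1)
    (φ' : L' ≃ₐ[F] L') (hcompat : ∀ x : L, φ' (algebraMap L L' x) = algebraMap L L' (φ x))
    {q N' : ℕ} (hN' : φ' ^ N' = 1) (hnN : n ∣ N')
    (hcard' : Nat.card (IsLocalRing.ResidueField R') = q ^ N')
    (hfrob' : ∀ a : R', ∃ a' : R', algebraMap R' L' a' = φ' (algebraMap R' L' a) ∧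
      IsLocalRing.residue R' a' = IsLocalRing.residue R' a ^ q)
    (hdesc : ∀ x : L', (φ' ^ n) x = x → x ∈ Set.range (algebraMap L L'))
    {ϖ' : R'} (hϖ' : Irreducible ϖ') {π : F} (hπ : algebraMap F L' π = algebraMap R' L' ϖ') :
    ∀ Q : (X.baseChange L).toAffine.Point,
      (∀ σ : L ≃ₐ[F] L, σ • Q - Q ∈ (X.baseChange L).goodReductionSubgroup R) →
        ∃ Q' : (X.baseChange L).toAffine.Point, (∀ σ : L ≃ₐ[F] L, σ • Q' = Q') ∧
          Q - Q' ∈ (X.baseChange L).goodReductionSubgroup R := by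
  obtain ⟨w', hw', hiso⟩ := exists_integers_and_algEquiv_eq L' R' hR'
  exact hα_of_nonsplit_odd X L L' R R' w' hw' W₀' hX' hR' hW' hα φ hφ hn φ' hcompat (hiso φ')
    hN' hnN hcard' hfrob' hdesc hϖ' hπ

end Exports

end Summit.BirchSwinnertonDyer.Rank1Residual.X11b.Three.JetchevKummer

end
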